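import Summits.ValiantsHypothesis.ValiantsHypothesis.Theses.LacunarySymmetroid
import Summits.ValiantsHypothesis.ValiantsHypothesis.Theorems.LacunarySymmetroidMatrixDescartesCensusDoorA
import Summits.ValiantsHypothesis.ValiantsHypothesis.Theorems.LacunarySymmetroidMatrixDescartesCensusDoorA34Link
import Summits.ValiantsHypothesis.ValiantsHypothesis.Theorems.LacunarySymmetroidMatrixDescartesCensusDoorA34TwoSingularLetters
import Summits.ValiantsHypothesis.ValiantsHypothesis.Theorems.LacunarySymmetroidMatrixDescartesCensusDoorA34RankOneLetter
import Summits.ValiantsHypothesis.ValiantsHypothesis.Theorems.LacunarySymmetroidMatrixDescartesCensusDoorA34NullTopLift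
import Summits.ValiantsHypothesis.ValiantsHypothesis.Theorems.LacunarySymmetroidMatrixDescartesCensusDoorA34NullNullLift
import Summits.ValiantsHypothesis.ValiantsHypothesis.Theorems.LacunarySymmetroidMatrixDescartesCensusDoorA34NullTopSeventeen
import Summits.ValiantsHypothesis.ValiantsHypothesis.Theorems.LacunarySymmetroidMatrixDescartesCensusDoorA34NullNullFifteen
import Summits.ValiantsHypothesis.ValiantsHypothesis.Theorems.LacunarySymmetroidMatrixDescartesCensusDoorA34NullTopBlocks

/-!
# Crux `DoorA34` (stmt-ValiantsHypothesis-19980) — LINE «strata»: deficiency one on the NULL STRATA + END-UNFOLDING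

Skeleton line for the crux item `Summit.ValiantsHypothesis.ValiantsHypothesis.Theses.LacunarySymmetroid.DoorA34`
(route `LacunarySymmetroid`, support item rank 9; `= PosRootLawAt 3 4 18` by `Iff.rfl`, `Census.doorA34_item_iff_posRootLawAt`):
«every 4-term real SYMMETRIC 3 × 3 lacunary pencil `∑ₗ X^(d l) • S l` has at most 18 distinct positive real zeros of its
determinant» (Descartes ceiling 19; kernel register `18 ≤ ζ_sym(3,4) ≤ 19`, `Census.doorA34_iff_register`).
Content: desk g21 draft `HOME/lead/g21/lines/DoorA34-strata-LINE.md` (sha16 430670a60a13424f), typed by the crux-plan seat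
`cruxplan-stmt-ValiantsHypothesis-19980-strata` (2026-08-27).  Three registered stubs `stub_unfold`, `stub_nullTopCeiling`,
`stub_nullNullCeiling`; kernel-checked composition `DoorA34_of`; the hypothesis-free `DoorA34_skeleton` concludes the crux BY NAME.

HONEST FRAMING.  `DoorA34` is OPEN and is asserted nowhere: the three `stub_*` below are OPEN sub-goals (placeholders), everything
else in this file is proved.  Nothing here bears on `Theses.LacunarySymmetroid.MatrixDescartes` (stmt-ValiantsHypothesis-18050, consumed by the
route only at fat formats) or on `VP ≠ VNP`.  The register `ζ_sym(3,4) ∈ {18, 19}` is unchanged by this file.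

WHY THIS LINE.  door-p3 g10's EXACT STRATA LAW, located on the full `(3,4)` census (report `HOME/DOOR-A34-P3G10-REPORT.md`
§2b/§3/§5) with kernel normal forms landed `--supports` this item: every census row with `≥ 17` positive roots is an END-UNFOLDING of a
NULL-STRATUM object sitting exactly one below its stratum ceiling — bulk 17 = null-null 15 + 2, rail 17 = null-top 16 + 1, all twelve
18-rows = null-top chain-17 + 1 (anatomy `9+1+4+1+2` = flag `(4,2)`).  Kernel of record: isotropic sub-door normal form (p553046,
`…CensusDoorA34Isotropic`), singular letter ⇒ `Z₊ ≤ 18` on every support (`Census.posRoots_le_18_of_det_letter_eq_zero`), null-null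
stratum ceiling `17` (p555222, `Census.posRoots_le_17_of_singular_ends`) with an exact null-null object `15 ≤ Z₊ ≤ 17` on `(0,8,14,23)`
(p558265, `Census.NullNullFifteen081423.nullNull_window`), an exact null-top object with `17 ≤ Z₊ ≤ 18` on `(0,1,4,359)` (p559152,
`Census.NullTopSeventeen014359`), rank-one letter ⇒ `Z₊ ≤ 15` (p559805, `Census.posRoots_le_15_of_rank_le_one`), the null-top block
identity `det = det G + X^N·tr(adj G·S₃) + X^{2N}·tr(adj S₃·G)` (p561661, `Census.det_pencil_nullTop_eq_blocks`), the end lifts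
(`Census.nineteen_of_nullTop_eighteen`, `Census.nineteen_of_nullNull_seventeen`: a null-top chain-18, resp. a null-null chain-17, with
adjugate-rank end kernels UNFOLDS to a nineteen), and the `(3,4)` pseudo-nineteens on `(0,2,5,42)` / `(0,2,5,64)` (p553659) showing that
{signs + C25 (+ window-4)} cannot prove the rail rows.  Hence, in chain currency, `DoorA34 ⟺` DEFICIENCY ONE on the null strata
(«no chain-18 on {det S₃ = 0}», «no chain-17 on {det S₀ = det S₃ = 0}») plus the UNFOLDING implication run backwards.  The line types
exactly that: `stub_unfold` (the structural step: a symmetric nineteen degenerates to a null-top eighteen or a null-null seventeen),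
`stub_nullTopCeiling` (`≤ 17` on the null-top stratum), `stub_nullNullCeiling` (`≤ 16` on the null-null stratum).  The strata are typed
in the tree's own currency — inline hypotheses `(S 3).det = 0` / `(S 0).det = 0` over sorted supports `StrictMono d` (census normal form,
`Census.doorA34_iff_strictMono`) — so that every stub can be restated verbatim in a `Theorems/` file (no definition of this work file is
needed to state a stub).

WHY EASIER (the transfer).  On the null-top stratum the top letter satisfies one real condition (`det S₃ = 0`: a kernel line `k` and a
rank-≤-1 adjugate `γ·kkᵀ`), the determinant loses the monomial `X^(3·d 3)` (at most 19 of the 20 triple-sum monomials survive, so Descartes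
gives `≤ 18`, and `≤ 17` unless the 19-letter sign word is FULLY alternating) and acquires EXACT structure: with `G = ∑_{l<3} X^(d l) S l`, `det = det G + X^N·tr(adj G·S₃) + X^{2N}·tr(adj S₃·G)`
and `adj S₃ = γ·kkᵀ` is rank one, so the top block is the single quadratic form `γ·kᵀGk` — a `(1,3)` trinomial window — and the middle
block is a `2 × 2`-minor pencil; the flag `(γ₁, γ₂)` tools of the cell (`…CensusDoorA34FlagLaw`, `…EndLetter` ray/interval laws,
`…KernelLines/KernelPlanes`) then act on three explicitly separated exponent windows.  On the null-null stratum both ends are so constrained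
(at most `18` monomials; the ceiling `17` is already in the kernel, the stub is the missing `−1`).

WHY NOVEL (search-before-claim, corpus fts+hybrid+vec AND galaxy, 2026-08-27).  A stratification of the symmetric `(3,4)` pencil space by
the vanishing of the END letters' determinants, with root counts controlled stratum-by-stratum through end-unfolding: no hits for
`lit galaxy search --star all` «fewnomial|matrix pencil|Descartes», «lacunary polynomial|sparse polynomial real roots|symmetric determinantal»,
«real tau-conjecture|real τ-conjecture|sums of products of sparse polynomials»; `lit search --hybrid` «determinantal pencil stratification
singular end coefficient real roots» returns only generic real-algebraic-geometry texts (Basu–Pollack–Roy; Landsberg) — nothing on strata of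
lacunary symmetric pencils; `lit vsearch` of the `stub_unfold` statement: nothing relevant.  Nearest prior art found: Koiran–Portier–Tavenas,
«A Wronskian approach to the real τ-conjecture», J. Symb. Comput. 68 (2015) [corpus:paper:arxiv-1205.1015 p.2–3; doi:10.1016/j.jsc.2014.09.036]
(Wronskian bounds for real roots of sums of products of sparse polynomials — no end-coefficient strata, no symmetric structure).

CHEAPEST FALSIFIER.  For the crux: ONE symmetric `(3,4)` pencil with `19` distinct positive roots (`Census.not_doorA34_iff`).  For the stubs,
the finite checks the draft asked for were RUN by this seat (exact integer arithmetic, Descartes sign count + Sturm, local, seconds):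
p558265's null-null object on `(0,8,14,23)` has EXACTLY `15` distinct positive roots (18 monomials, 15 sign changes, Sturm count 15,
squarefree) — so `stub_nullNullCeiling` (`≤ 16`) survives its named falsifier; p559152's null-top object on `(0,1,4,359)` has sign word
`+-+-+-+-+-+-++-+-+-` (19 monomials, 17 sign changes), hence with the kernel's `17 ≤ Z₊` EXACTLY `17` — so `stub_nullTopCeiling` (`≤ 17`)
survives and is SHARP if true.  For `stub_unfold` specifically: a located 18-row whose anatomy is NOT «null-top chain-17 + 1» (none among
the twelve of record).

DISPROOF USED.  None exists: the crux directory `Cruxes/DoorA34/` had no `Disproof.lean`, no ideas and no other lines at typing time;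
`ledger negatives --problem ValiantsHypothesis` lists no statement about `PosRootLawAt 3 4 _`.

SHRED / COSTUME CHECK.  Three stubs.  `stub_unfold` carries the difficulty and says so (XL; no kernel piece; like every statement with a
`19 ≤ card` hypothesis it is implied by the crux itself — `unfold_of_doorA34` below records this honestly — and its content is the
MECHANISM: given the two ceilings it is equivalent to the crux).  `stub_nullTopCeiling` / `stub_nullNullCeiling` quantify over PROPER closed
strata (codimension 1 and 2), are strictly below the Descartes ceiling there, are NOT restatements of the crux (in card currency they are not
even formal consequences of it: the end lifts need alternation chains and adjugate-rank kernels), and each has a kernel anchor one above it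
(`nullTop_ceiling_kernel : ≤ 18`, `nullNull_ceiling_kernel : ≤ 17`) and an exact object one or two below it (`nullTop_seventeen_exists`,
`nullNull_fifteen_exists`).

SEATS → STUBS (director-valiant g8; six live prover seats door-p1..p4, engine-1/2).  door-p3 line (g11 successor): `stub_nullNullCeiling`
first (block anatomy on `(S 0).det = (S 3).det = 0`; the exact object is `15`, two below), then `stub_nullTopCeiling` (flag `(γ₁,γ₂)` on the
three windows of `Census.det_pencil_nullTop_eq_blocks`; by-product target: `card = 17` for p559152's object via its 17 sign changes), then
`stub_unfold` as located law → typed degeneration lemma (end-unfolding of `Census.nineteen_of_nullTop_eighteen` run backwards along a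
root-preserving path).  Support-level certificates (`PosRootLawOn 3 4 18 d` rows, strata objects, chamber laws) keep landing
`--supports stmt-ValiantsHypothesis-19980` as before.
-/

-- `Summit.ValiantsHypothesis.ValiantsHypothesis.…` repeats a component by the D-0017 layout (single-conjunct summit).
set_option linter.dupNamespace false
set_option autoImplicit false

namespace Summit.ValiantsHypothesis.ValiantsHypothesis.Cruxes.DoorA34.Strata

open scoped BigOperators Matrix
open Summit.ValiantsHypothesis.ValiantsHypothesis.Theorems.MatrixDescartes.Negative (PosRootLawAt)
open Summit.ValiantsHypothesis.ValiantsHypothesis.Theorems.LacunarySymmetroidMatrixDescartes (PosRootLawOn DoorA34)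
open Summit.ValiantsHypothesis.ValiantsHypothesis.Theorems.LacunarySymmetroidMatrixDescartes.Census

/-! ## Sorted supports: the end cube exponents are uniquely represented (feeds `Census.posRoots_le_17_of_singular_ends`) -/

/-- On a sorted support the bottom cube exponent `3·d 0` is attained only by the constant triple `(0,0,0)`. [folklore] -/
theorem eq_bot_of_sum_eq_three_mul (d : Fin 4 → ℕ) (hd : StrictMono d) (f : Fin 3 → Fin 4)
    (hf : (∑ k, d (f k)) = 3 * d 0) (k : Fin 3) : f k = 0 := by
  have hle : ∀ i ∈ (Finset.univ : Finset (Fin 3)), d 0 ≤ d (f i) :=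
    fun i _ => hd.monotone (Fin.zero_le (f i))
  have hsum : (∑ _i : Fin 3, d 0) = ∑ i, d (f i) := by
    rw [hf, Finset.sum_const, Finset.card_univ, Fintype.card_fin, smul_eq_mul]
  exact (hd.injective (((Finset.sum_eq_sum_iff_of_le hle).1 hsum) k (Finset.mem_univ k))).symm

/-- On a sorted support the top cube exponent `3·d 3` is attained only by the constant triple `(3,3,3)`. [folklore] -/
theorem eq_top_of_sum_eq_three_mul (d : Fin 4 → ℕ) (hd : StrictMono d) (f : Fin 3 → Fin 4)
    (hf : (∑ k, d (f k)) = 3 * d 3) (k : Fin 3) : f k = 3 := by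
  have hle : ∀ i ∈ (Finset.univ : Finset (Fin 3)), d (f i) ≤ d 3 :=
    fun i _ => hd.monotone (Fin.le_last (f i))
  have hsum : (∑ i, d (f i)) = ∑ _i : Fin 3, d 3 := by
    rw [hf, Finset.sum_const, Finset.card_univ, Fintype.card_fin, smul_eq_mul]
  exact hd.injective (((Finset.sum_eq_sum_iff_of_le hle).1 hsum) k (Finset.mem_univ k))

/-- Sortedness of an explicit four-term support from its three gaps. [folklore] -/
theorem strictMono_vec4 {a b c e : ℕ} (h₁ : a < b) (h₂ : b < c) (h₃ : c < e) :
    StrictMono (![a, b, c, e] : Fin 4 → ℕ) := by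
  rw [Fin.strictMono_iff_lt_succ]
  intro i
  fin_cases i
  all_goals first | exact h₁ | exact h₂ | exact h₃

/-! ## Kernel anchors: what the tree already proves one step above each stub, and the exact objects below -/

/-- KERNEL ANCHOR above `stub_nullTopCeiling`: on the null-top stratum `Z₊ ≤ 18` (any support; `Census.posRoots_le_18_of_det_letter_eq_zero`).
The stub asks for `≤ 17`. [folklore] -/
theorem nullTop_ceiling_kernel (d : Fin 4 → ℕ) (S : Fin 4 → Matrix (Fin 3) (Fin 3) ℝ) (h3 : (S 3).det = 0) :
    ((∑ l, (Polynomial.X : Polynomial ℝ) ^ d l • (S l).map Polynomial.C).det.roots.toFinset.filter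
      (fun t => 0 < t)).card ≤ 18 :=
  posRoots_le_18_of_det_letter_eq_zero d S 3 h3

/-- KERNEL ANCHOR above `stub_nullNullCeiling`: on the null-null stratum over a SORTED support `Z₊ ≤ 17`
(`Census.posRoots_le_17_of_singular_ends`; the unique-cube hypotheses follow from `StrictMono d`).  The stub asks for `≤ 16`. [folklore] -/
theorem nullNull_ceiling_kernel (d : Fin 4 → ℕ) (S : Fin 4 → Matrix (Fin 3) (Fin 3) ℝ) (hd : StrictMono d)
    (h0 : (S 0).det = 0) (h3 : (S 3).det = 0) :
    ((∑ l, (Polynomial.X : Polynomial ℝ) ^ d l • (S l).map Polynomial.C).det.roots.toFinset.filter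
      (fun t => 0 < t)).card ≤ 17 :=
  posRoots_le_17_of_singular_ends d S (hd (show (0 : Fin 4) < 3 by decide)).ne
    (fun f hf k => eq_bot_of_sum_eq_three_mul d hd f hf k) (fun f hf k => eq_top_of_sum_eq_three_mul d hd f hf k) h0 h3

/-- EXACT OBJECT below `stub_nullTopCeiling` (p559152, `Census.NullTopSeventeen014359`): a symmetric pencil ON the null-top stratum over
the sorted support `(0,1,4,359)` with `17 ≤ Z₊` — so `≤ 17` is SHARP if true (this seat's exact sign count gives `Z₊ = 17` for it). [folklore] -/
theorem nullTop_seventeen_exists :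
    ∃ (d : Fin 4 → ℕ) (S : Fin 4 → Matrix (Fin 3) (Fin 3) ℝ), (∀ l, (S l).IsSymm) ∧ StrictMono d ∧ (S 3).det = 0 ∧
      17 ≤ ((∑ l, (Polynomial.X : Polynomial ℝ) ^ d l • (S l).map Polynomial.C).det.roots.toFinset.filter
        (fun t => 0 < t)).card :=
  ⟨![0, 1, 4, 359], _, NullTopSeventeen014359.symm, strictMono_vec4 (by norm_num) (by norm_num) (by norm_num),
    NullTopSeventeen014359.det_top_letter, NullTopSeventeen014359.seventeen_le_card_posRoots⟩

/-- EXACT OBJECT below `stub_nullNullCeiling` (p558265, `Census.NullNullFifteen081423`): a symmetric pencil ON the null-null stratum over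
the sorted support `(0,8,14,23)` with `15 ≤ Z₊` (this seat's Sturm count: exactly `15`). [folklore] -/
theorem nullNull_fifteen_exists :
    ∃ (d : Fin 4 → ℕ) (S : Fin 4 → Matrix (Fin 3) (Fin 3) ℝ), (∀ l, (S l).IsSymm) ∧ StrictMono d ∧
      (S 0).det = 0 ∧ (S 3).det = 0 ∧
      15 ≤ ((∑ l, (Polynomial.X : Polynomial ℝ) ^ d l • (S l).map Polynomial.C).det.roots.toFinset.filter
        (fun t => 0 < t)).card :=
  ⟨![0, 8, 14, 23], _, NullNullFifteen081423.symm, strictMono_vec4 (by norm_num) (by norm_num) (by norm_num),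
    NullNullFifteen081423.det_end_letters.1, NullNullFifteen081423.det_end_letters.2,
    NullNullFifteen081423.fifteen_le_card_posRoots⟩

/-! ## The three registered stubs (OPEN sub-goals; the only placeholders in this file) -/

/-- stub 1 (XL — the structural crux of the line): UNFOLDING RUN BACKWARDS.  A sorted, normalised (`d 0 = 0`) real symmetric `(3,4)`
pencil with `≥ 19` distinct positive det-roots degenerates — send an END letter to its null stratum along a root-preserving deformation
(door-p3 report §3: the census maximisers are end-unfoldings `S₃ = S₃⁰ + η·kkᵀ` of null-stratum objects, `Census.nineteen_of_nullTop_eighteen`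
read backwards) — to a symmetric NULL-TOP pencil (some sorted support) with `≥ 18` distinct positive roots OR a symmetric NULL-NULL pencil with
`≥ 17`.  Located exactly on all census rows `≥ 17`; no kernel piece yet.  Honest label: implied by the crux (vacuous premise under
`DoorA34`, see `unfold_of_doorA34`); given stubs 2–3 it is equivalent to the crux; its content is the degeneration MECHANISM.
Why it might fail: a nineteen whose end letters are far from singular (macroscopic unfolding destroys interior roots before the end
letter reaches the stratum) — none located. -/
theorem stub_unfold :
    ∀ (d : Fin 4 → ℕ) (S : Fin 4 → Matrix (Fin 3) (Fin 3) ℝ), (∀ l, (S l).IsSymm) → StrictMono d → d 0 = 0 →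
      19 ≤ ((∑ l, (Polynomial.X : Polynomial ℝ) ^ d l • (S l).map Polynomial.C).det.roots.toFinset.filter
        (fun t => 0 < t)).card →
      (∃ (d' : Fin 4 → ℕ) (S' : Fin 4 → Matrix (Fin 3) (Fin 3) ℝ), (∀ l, (S' l).IsSymm) ∧ StrictMono d' ∧
          (S' 3).det = 0 ∧
          18 ≤ ((∑ l, (Polynomial.X : Polynomial ℝ) ^ d' l • (S' l).map Polynomial.C).det.roots.toFinset.filter
            (fun t => 0 < t)).card) ∨
      (∃ (d' : Fin 4 → ℕ) (S' : Fin 4 → Matrix (Fin 3) (Fin 3) ℝ), (∀ l, (S' l).IsSymm) ∧ StrictMono d' ∧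
          (S' 0).det = 0 ∧ (S' 3).det = 0 ∧
          17 ≤ ((∑ l, (Polynomial.X : Polynomial ℝ) ^ d' l • (S' l).map Polynomial.C).det.roots.toFinset.filter
            (fun t => 0 < t)).card) := by
  sorry

/-- stub 2 (L): NULL-TOP CEILING `17` — DEFICIENCY ONE on the closed stratum `{det S₃ = 0}` over sorted supports: at most `17` distinct
positive det-roots (kernel: `≤ 18`, `nullTop_ceiling_kernel`; exact object with `17`, `nullTop_seventeen_exists` — SHARP if true).  Chain
reading: no chain-18 on the null-top stratum (else `Census.nineteen_of_nullTop_eighteen` unfolds it to a nineteen).  Route in: the block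
identity `Census.det_pencil_nullTop_eq_blocks` (`det = det G + X^N·tr(adj G·S₃) + X^{2N}·tr(adj S₃·G)`, `adj S₃` rank ≤ 1) and the
flag/end-letter laws on its three windows; rank-one top letter is settled (`Census.posRoots_le_15_of_rank_le_one`).
Why it might fail: a null-top pencil with 18 distinct positive roots — by Descartes its (at most) 19-letter sign word must then be FULLY
alternating, with the top window `γ·kᵀGk` and the middle `2 × 2`-minor window realising the alternation simultaneously; none located. -/
theorem stub_nullTopCeiling :
    ∀ (d : Fin 4 → ℕ) (S : Fin 4 → Matrix (Fin 3) (Fin 3) ℝ), (∀ l, (S l).IsSymm) → StrictMono d → (S 3).det = 0 →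
      ((∑ l, (Polynomial.X : Polynomial ℝ) ^ d l • (S l).map Polynomial.C).det.roots.toFinset.filter
        (fun t => 0 < t)).card ≤ 17 := by
  sorry

/-- stub 3 (L): NULL-NULL CEILING `16` — deficiency one on the closed stratum `{det S₀ = det S₃ = 0}` over sorted supports: at most `16`
distinct positive det-roots (kernel: `≤ 17`, `nullNull_ceiling_kernel`; exact object with `15`, `nullNull_fifteen_exists`; this seat's exact
count of that object is `15`, not `17`, so the stub survives its named falsifier).  Chain reading: no chain-17 on the null-null stratum (else
`Census.nineteen_of_nullNull_seventeen` unfolds it to a nineteen).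
Why it might fail: a null-null pencil with 17 distinct positive roots = a fully alternating (at most) 18-letter sign word realised with
both end blocks rank-one-constrained; none located (census null-null maximum of record: 15). -/
theorem stub_nullNullCeiling :
    ∀ (d : Fin 4 → ℕ) (S : Fin 4 → Matrix (Fin 3) (Fin 3) ℝ), (∀ l, (S l).IsSymm) → StrictMono d →
      (S 0).det = 0 → (S 3).det = 0 →
      ((∑ l, (Polynomial.X : Polynomial ℝ) ^ d l • (S l).map Polynomial.C).det.roots.toFinset.filter
        (fun t => 0 < t)).card ≤ 16 := by
  sorry

/-! ## Composition (kernel-checked): the three stubs give the crux -/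

/-- **COMPOSITION.**  Unfolding + the two stratum ceilings ⇒ the cell's typed target `DoorA34 = PosRootLawAt 3 4 18`: reduce to sorted
normalised supports (`Census.doorA34_iff_strictMono`), assume a pencil with `≥ 19` positive roots, unfold it to a null stratum, contradict
the ceiling there.  Real proof; the hypotheses are VERBATIM the three stub statements. [folklore] -/
theorem DoorA34_of
    (h₁ : ∀ (d : Fin 4 → ℕ) (S : Fin 4 → Matrix (Fin 3) (Fin 3) ℝ), (∀ l, (S l).IsSymm) → StrictMono d → d 0 = 0 →
      19 ≤ ((∑ l, (Polynomial.X : Polynomial ℝ) ^ d l • (S l).map Polynomial.C).det.roots.toFinset.filter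
        (fun t => 0 < t)).card →
      (∃ (d' : Fin 4 → ℕ) (S' : Fin 4 → Matrix (Fin 3) (Fin 3) ℝ), (∀ l, (S' l).IsSymm) ∧ StrictMono d' ∧
          (S' 3).det = 0 ∧
          18 ≤ ((∑ l, (Polynomial.X : Polynomial ℝ) ^ d' l • (S' l).map Polynomial.C).det.roots.toFinset.filter
            (fun t => 0 < t)).card) ∨
      (∃ (d' : Fin 4 → ℕ) (S' : Fin 4 → Matrix (Fin 3) (Fin 3) ℝ), (∀ l, (S' l).IsSymm) ∧ StrictMono d' ∧
          (S' 0).det = 0 ∧ (S' 3).det = 0 ∧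
          17 ≤ ((∑ l, (Polynomial.X : Polynomial ℝ) ^ d' l • (S' l).map Polynomial.C).det.roots.toFinset.filter
            (fun t => 0 < t)).card))
    (h₂ : ∀ (d : Fin 4 → ℕ) (S : Fin 4 → Matrix (Fin 3) (Fin 3) ℝ), (∀ l, (S l).IsSymm) → StrictMono d → (S 3).det = 0 →
      ((∑ l, (Polynomial.X : Polynomial ℝ) ^ d l • (S l).map Polynomial.C).det.roots.toFinset.filter
        (fun t => 0 < t)).card ≤ 17)
    (h₃ : ∀ (d : Fin 4 → ℕ) (S : Fin 4 → Matrix (Fin 3) (Fin 3) ℝ), (∀ l, (S l).IsSymm) → StrictMono d →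
      (S 0).det = 0 → (S 3).det = 0 →
      ((∑ l, (Polynomial.X : Polynomial ℝ) ^ d l • (S l).map Polynomial.C).det.roots.toFinset.filter
        (fun t => 0 < t)).card ≤ 16) :
    DoorA34 := by
  rw [doorA34_iff_strictMono]
  intro d hd hd0 S hS
  refine not_lt.mp fun hlt => ?_
  rcases h₁ d S hS hd hd0 (by omega) with ⟨d', S', hS', hd', h3, hc⟩ | ⟨d', S', hS', hd', h0, h3, hc⟩
  · have h17 := h₂ d' S' hS' hd' h3
    omega
  · have h16 := h₃ d' S' hS' hd' h0 h3
    omega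

/-- **THE SKELETON THEOREM** — the unique hypothesis-free theorem of this file concluding the crux decl
`Theses.LacunarySymmetroid.DoorA34` BY NAME, from the three stubs through `DoorA34_of` and the `Iff.rfl` link
`Census.doorA34_item_of`.  It is exactly as open as the stubs. -/
theorem DoorA34_skeleton : Summit.ValiantsHypothesis.ValiantsHypothesis.Theses.LacunarySymmetroid.DoorA34 :=
  doorA34_item_of (DoorA34_of stub_unfold stub_nullTopCeiling stub_nullNullCeiling)

/-! ## Honest bookkeeping around the stubs -/

/-- `stub_unfold` is implied by the crux (its premise `19 ≤ card` is then empty): the stub is not a strengthening of `DoorA34`, its content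
is the mechanism; given stubs 2–3 it is equivalent to the crux (`DoorA34_of`). [folklore] -/
theorem unfold_of_doorA34 (h : Summit.ValiantsHypothesis.ValiantsHypothesis.Theses.LacunarySymmetroid.DoorA34) :
    ∀ (d : Fin 4 → ℕ) (S : Fin 4 → Matrix (Fin 3) (Fin 3) ℝ), (∀ l, (S l).IsSymm) → StrictMono d → d 0 = 0 →
      19 ≤ ((∑ l, (Polynomial.X : Polynomial ℝ) ^ d l • (S l).map Polynomial.C).det.roots.toFinset.filter
        (fun t => 0 < t)).card →
      (∃ (d' : Fin 4 → ℕ) (S' : Fin 4 → Matrix (Fin 3) (Fin 3) ℝ), (∀ l, (S' l).IsSymm) ∧ StrictMono d' ∧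
          (S' 3).det = 0 ∧
          18 ≤ ((∑ l, (Polynomial.X : Polynomial ℝ) ^ d' l • (S' l).map Polynomial.C).det.roots.toFinset.filter
            (fun t => 0 < t)).card) ∨
      (∃ (d' : Fin 4 → ℕ) (S' : Fin 4 → Matrix (Fin 3) (Fin 3) ℝ), (∀ l, (S' l).IsSymm) ∧ StrictMono d' ∧
          (S' 0).det = 0 ∧ (S' 3).det = 0 ∧
          17 ≤ ((∑ l, (Polynomial.X : Polynomial ℝ) ^ d' l • (S' l).map Polynomial.C).det.roots.toFinset.filter
            (fun t => 0 < t)).card) := by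
  intro d S hS _hd _hd0 h19
  have h18 := h d S hS
  omega

/-- The stratum ceilings in the currency the END LIFTS speak (what the crux itself already gives, for comparison with stubs 2–3): under
`DoorA34`, on a support with a unique top exponent no symmetric null-top pencil whose top kernel has adjugate rank carries an alternation
chain of `19` points (`Census.no_nullTop_eighteen_of_posRootLawOn`).  Stubs 2–3 are the CARD-currency statements one needs in the other
direction. [folklore] -/
theorem no_nullTop_chain18_of_doorA34 (h : Summit.ValiantsHypothesis.ValiantsHypothesis.Theses.LacunarySymmetroid.DoorA34)
    (d : Fin 4 → ℕ) (h3 : ∀ l, l ≠ 3 → d l < d 3)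
    (S : Fin 4 → Matrix (Fin 3) (Fin 3) ℝ) (hS : ∀ l, (S l).IsSymm) (hdet : (S 3).det = 0)
    (k : Fin 3 → ℝ) (hk : k ⬝ᵥ ((S 3).adjugate *ᵥ k) ≠ 0) (s : ℝ) (a : Fin 19 → ℝ) :
    ¬ AltChain ((∑ l, (Polynomial.X : Polynomial ℝ) ^ d l • (S l).map Polynomial.C).det) 18 s a :=
  no_nullTop_eighteen_of_posRootLawOn (fun S' hS' => h d S' hS') h3 S hS hdet k hk s a

end Summit.ValiantsHypothesis.ValiantsHypothesis.Cruxes.DoorA34.Strata
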